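import Summits.QuantumFields.YangMills.Theorems.FluctuationComparisonRegPrIntLS2BetaCoarseCurlJunction
import Summits.QuantumFields.YangMills.Theorems.BackwardLiouvilleRigidityAdmFRFrameInhabited
import HarnessLib

/-!
# S2β · (SCT″-c)₁, S-KER LETTER 1 — «RELATIVE-PLAQUETTE JUNCTIONS FOR THE c₁ BUDGET»: the GROUP-currency relative plaquette size of a chart pair `(Θ(Z)·V, V)` is the
# linearised curl PLUS the universal second-order remainder, in the LEFT-relative reading of the purse (`V(∂p)⁻¹·U′(∂p)`), squared; and at the finest level the squared size
# is at most `4·(1 − reTr)` of the same relative plaquette — the two junction letters the (SCT″-c)₁ supplier composes with ✓`weighted_readMax_sq_le`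

Cell `ym3-torus` (YM ladder rung R3 = continuum `SU(2)` Yang–Mills on the three-torus at fixed lattice data — a RUNG: NOT d = 4, NOT infinite volume, NOT a mass gap,
NOT Clay).  Width seat «width 16» `ym3-torus-px16` (gen 23), S2β pairing-letter lane holder; crux `stmt-QuantumFields-20520`, LINE g18-1 S2β.
`--kind proof --supports stmt-QuantumFields-20520 --as helper`, count-neutral, DEFINITION-FREE (0 `def`, 0 `instance`, 0 `notation`, 0 `sorry`, default heartbeats).

WHY.  The c₁ TEXT of record (px16 g23 2026-08-31T19:48Z) reads the relative plaquettes of the descended pair in GROUP currency, LEFT-relative as the purse does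
(`dist1 ((plaqHol V p)⁻¹·plaqHol U′ p)`); px13's CURL-AVG rows (✓p831575) and the composed-kernel dock run in LINEARISED currency `‖Y_V(∂p)[Ẑ]‖`; ✓D
`norm_coe_relPlaq_sub_one_sub_curl_le` is the RIGHT-relative junction with remainder `e^S − 1 − S`.  THIS FILE: the left-relative, `dist1`, squared editions, and the finest-level
comparison with `1 − reTr` (✓`dist1_sq_le_four_mul`), so the supplier's inequalities chain by `exact`.

WHAT IS PROVED (sorry-free; generic `P : Params`, any level `k`).
§1 ★`dist1_relPlaq_left_eq_right` — `dist1 (V(∂p)⁻¹·U′(∂p)) = dist1 (U′(∂p)·V(∂p)⁻¹)` (lit ✓`dist1_inv_mul_eq`).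
§2 ★★`dist1_relPlaq_le_curl_add_rem` — `SU(N)`: `dist1 (V(∂p)⁻¹·(Θ(Z)V)(∂p)) ≤ ‖Y_V(∂p)[Ẑ]‖ + (e^S − 1 − S)`, `S` = the four chart sizes on `∂p` (✓D §3 + `dist1 = ‖↑· − 1‖`).
§3 ★★`dist1_relPlaq_sq_le` — the squared edition: `dist1(…)² ≤ 2·‖Y_V(∂p)[Ẑ]‖² + 2·(e^S − 1 − S)²`.
§4 ★`sum_dist1_relPlaq_sq_le_four_mul` — `SU(2)`, any finite set of plaquettes: `Σ_p dist1 (V(∂p)⁻¹U(∂p))² ≤ 4·Σ_p (1 − reTr (V(∂p)⁻¹U(∂p)))` (the purse's REL currency).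

HONEST SCOPE.  Matrix∕group bookkeeping over landed letters; nothing of Bałaban's analysis is asserted or proved ([Balaban1985Averaging] (9) p.19, (19)–(20) p.21; [Balaban1987RG1] (0.8),
(0.11) p.253); (SCT″-c)₁₂₃, NC-ROW′, (ST″), LOC″, (RSP), (BKG), h3 HYPOTHESES elsewhere; GAP♯∘ (`stub_uniformFibreGapOrbit`, registry untouched, 0∕5), S2β, crux 20520, 19936, 19200 and
`YM3TorusSU2` are NOT proved; no registered stub is closed; rung R3 = SU(2) YM₃ on T³ — NOT d = 4, NOT infinite volume, NOT a mass gap, NOT Clay; the Yang–Mills mass gap is NOT proved.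
-/

set_option autoImplicit false

noncomputable section

namespace Summit.QuantumFields.YangMills.Theorems.FluctuationComparisonRegPrIntLS2BetaRelPlaqCurlJunction

open scoped Matrix.Norms.L2Operator BigOperators
open Finset
open Literature.MathematicalPhysics.QuantumFieldTheory.Balaban1983to89
open Literature.MathematicalPhysics.QuantumFieldTheory.Balaban1983to89.T4Continuum
open Literature.MathematicalPhysics.QuantumFieldTheory.Balaban1983to89.HaarExponentialChart
open Literature.MathematicalPhysics.QuantumFieldTheory.Balaban1983to89.HaarExponentialChart.IsChartRep
open Summit.QuantumFields.YangMills.Theorems.FluctuationComparisonRegPrIntLS2BetaCoarseCurlJunction (norm_coe_relPlaq_sub_one_sub_curl_le)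
open Summit.QuantumFields.YangMills.Theorems.AdmFRFrameInhabited (dist1_sq_le_four_mul)
open Literature.MathematicalPhysics.QuantumFieldTheory.Balaban1983to89.BlockAveragingEMLLinearisedBackground

variable {P : Params} {N : ℕ} [NeZero N]

/-! ## §1 Left- and right-relative plaquettes have the same size -/

omit [NeZero N] in
/-- ★ `dist1 (V(∂p)⁻¹·U′(∂p)) = dist1 (U′(∂p)·V(∂p)⁻¹)` (the purse reads left-relative, ✓D reads right-relative; lit ✓`dist1_inv_mul_eq`). [folklore] -/
theorem dist1_relPlaq_left_eq_right {G : Type*} [GaugeGroup G] {k : ℕ} (U' V : GaugeField P k G) (p : Plaq P k) :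
    dist1 ((GaugeField.plaqHol V p)⁻¹ * GaugeField.plaqHol U' p) = dist1 (GaugeField.plaqHol U' p * (GaugeField.plaqHol V p)⁻¹) :=
  (B11GaugeGlue.dist1_inv_mul_eq (GaugeField.plaqHol V p) (GaugeField.plaqHol U' p)).trans
    (B11GaugeGlue.dist1_mul_inv_comm (GaugeField.plaqHol U' p) (GaugeField.plaqHol V p))

/-! ## §2 Group size ≤ linearised curl + second-order remainder -/

/-- ★★ **GROUP ≤ LINEARISED + REMAINDER** (`SU(N)`, any level, left-relative reading): for `U′(c) = Θ(Z c)·V c` and the plaquette `p = (y; μ < ν)`,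
`dist1 (V(∂p)⁻¹·U′(∂p)) ≤ ‖Y_V(∂p)[Ẑ]‖ + (e^S − 1 − S)`, `S = ‖Z⟨y,μ⟩‖ + ‖Z⟨y+e_μ,ν⟩‖ + ‖Z⟨y+e_ν,μ⟩‖ + ‖Z⟨y,ν⟩‖`. [cite: Balaban1985Averaging, (19)-(20) p.21, (58) p.27; Balaban1987RG1, (0.8) p.253] -/
theorem dist1_relPlaq_le_curl_add_rem {k : ℕ} (V : GaugeField P k (Matrix.specialUnitaryGroup (Fin N) ℂ)) (Z : PBond P k → (specialUnitaryLogChart (Fin N)).lie) (y : Site P k)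
    {μ ν : Fin P.d} (hμν : μ < ν) :
    dist1 ((GaugeField.plaqHol V ⟨y, μ, ν, hμν⟩)⁻¹ *
        GaugeField.plaqHol (fun c => (isChartRep_specialUnitaryGroup (n := Fin N)).expChart (Z c) * V c) ⟨y, μ, ν, hμν⟩) ≤
      ‖covWalkSum V (fun c => ((Z c : (specialUnitaryLogChart (Fin N)).lie) : Matrix (Fin N) (Fin N) ℂ)) (walk y [((μ, true) : Letter P.d), (ν, true), (μ, false), (ν, false)])‖ +
        (Real.exp (‖Z ⟨y, μ⟩‖ + ‖Z ⟨y.shift μ, ν⟩‖ + ‖Z ⟨y.shift ν, μ⟩‖ + ‖Z ⟨y, ν⟩‖) - 1 - (‖Z ⟨y, μ⟩‖ + ‖Z ⟨y.shift μ, ν⟩‖ + ‖Z ⟨y.shift ν, μ⟩‖ + ‖Z ⟨y, ν⟩‖)) := by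
  rw [dist1_relPlaq_left_eq_right]
  have hD := norm_coe_relPlaq_sub_one_sub_curl_le V Z y hμν
  set W : Matrix.specialUnitaryGroup (Fin N) ℂ := GaugeField.plaqHol (fun c => (isChartRep_specialUnitaryGroup (n := Fin N)).expChart (Z c) * V c) ⟨y, μ, ν, hμν⟩ *
      (GaugeField.plaqHol V ⟨y, μ, ν, hμν⟩)⁻¹ with hW
  set C : Matrix (Fin N) (Fin N) ℂ := covWalkSum V (fun c => ((Z c : (specialUnitaryLogChart (Fin N)).lie) : Matrix (Fin N) (Fin N) ℂ))
      (walk y [((μ, true) : Letter P.d), (ν, true), (μ, false), (ν, false)]) with hC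
  -- `dist1 W = ‖↑W − 1‖ = ‖(↑W − 1 − C) + C‖ ≤ ‖↑W − 1 − C‖ + ‖C‖`
  have hdist : dist1 W = ‖((W : Matrix.specialUnitaryGroup (Fin N) ℂ) : Matrix (Fin N) (Fin N) ℂ) - 1‖ := rfl
  rw [hdist]
  have e : ((W : Matrix.specialUnitaryGroup (Fin N) ℂ) : Matrix (Fin N) (Fin N) ℂ) - 1 = (((W : Matrix.specialUnitaryGroup (Fin N) ℂ) : Matrix (Fin N) (Fin N) ℂ) - 1 - C) + C := by abel
  rw [e]
  calc ‖(((W : Matrix.specialUnitaryGroup (Fin N) ℂ) : Matrix (Fin N) (Fin N) ℂ) - 1 - C) + C‖ ≤ ‖((W : Matrix.specialUnitaryGroup (Fin N) ℂ) : Matrix (Fin N) (Fin N) ℂ) - 1 - C‖ + ‖C‖ := norm_add_le _ _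
    _ ≤ _ := by rw [add_comm]; exact add_le_add le_rfl hD

/-! ## §3 Squared edition -/

/-- ★★ **SQUARED**: `dist1 (V(∂p)⁻¹·U′(∂p))² ≤ 2·‖Y_V(∂p)[Ẑ]‖² + 2·(e^S − 1 − S)²`. [cite: Balaban1985Averaging, (19)-(20) p.21; Balaban1987RG1, (0.8) p.253] -/
theorem dist1_relPlaq_sq_le {k : ℕ} (V : GaugeField P k (Matrix.specialUnitaryGroup (Fin N) ℂ)) (Z : PBond P k → (specialUnitaryLogChart (Fin N)).lie) (y : Site P k)
    {μ ν : Fin P.d} (hμν : μ < ν) :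
    dist1 ((GaugeField.plaqHol V ⟨y, μ, ν, hμν⟩)⁻¹ *
        GaugeField.plaqHol (fun c => (isChartRep_specialUnitaryGroup (n := Fin N)).expChart (Z c) * V c) ⟨y, μ, ν, hμν⟩) ^ 2 ≤
      2 * ‖covWalkSum V (fun c => ((Z c : (specialUnitaryLogChart (Fin N)).lie) : Matrix (Fin N) (Fin N) ℂ)) (walk y [((μ, true) : Letter P.d), (ν, true), (μ, false), (ν, false)])‖ ^ 2 +
        2 * (Real.exp (‖Z ⟨y, μ⟩‖ + ‖Z ⟨y.shift μ, ν⟩‖ + ‖Z ⟨y.shift ν, μ⟩‖ + ‖Z ⟨y, ν⟩‖) - 1 -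
          (‖Z ⟨y, μ⟩‖ + ‖Z ⟨y.shift μ, ν⟩‖ + ‖Z ⟨y.shift ν, μ⟩‖ + ‖Z ⟨y, ν⟩‖)) ^ 2 := by
  have h := dist1_relPlaq_le_curl_add_rem V Z y hμν
  have h0 : 0 ≤ dist1 ((GaugeField.plaqHol V ⟨y, μ, ν, hμν⟩)⁻¹ *
      GaugeField.plaqHol (fun c => (isChartRep_specialUnitaryGroup (n := Fin N)).expChart (Z c) * V c) ⟨y, μ, ν, hμν⟩) := GaugeGroup.dist1_nonneg _
  have h1 := pow_le_pow_left₀ h0 h 2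
  nlinarith [h1, sq_nonneg (‖covWalkSum V (fun c => ((Z c : (specialUnitaryLogChart (Fin N)).lie) : Matrix (Fin N) (Fin N) ℂ))
      (walk y [((μ, true) : Letter P.d), (ν, true), (μ, false), (ν, false)])‖ -
    (Real.exp (‖Z ⟨y, μ⟩‖ + ‖Z ⟨y.shift μ, ν⟩‖ + ‖Z ⟨y.shift ν, μ⟩‖ + ‖Z ⟨y, ν⟩‖) - 1 -
      (‖Z ⟨y, μ⟩‖ + ‖Z ⟨y.shift μ, ν⟩‖ + ‖Z ⟨y.shift ν, μ⟩‖ + ‖Z ⟨y, ν⟩‖)))]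

/-! ## §4 Finest level: the purse's `REL` dominates the squared sizes -/

omit [NeZero N] in
/-- ★ **`Σ_p dist1 (V(∂p)⁻¹U(∂p))² ≤ 4·Σ_p (1 − reTr (V(∂p)⁻¹U(∂p)))`** on `SU(2)`, any finite family of plaquettes (✓`dist1_sq_le_four_mul` termwise) — the junction from the
kernel part of (SCT″-c)₁ to the purse's `REL`. [cite: Balaban1987RG1, (0.11) p.253] -/
theorem sum_dist1_relPlaq_sq_le_four_mul {k : ℕ} (U V : GaugeField P k (Matrix.specialUnitaryGroup (Fin 2) ℂ)) (S : Finset (Plaq P k)) :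
    ∑ p ∈ S, dist1 ((GaugeField.plaqHol V p)⁻¹ * GaugeField.plaqHol U p) ^ 2 ≤
      4 * ∑ p ∈ S, (1 - reTr ((GaugeField.plaqHol V p)⁻¹ * GaugeField.plaqHol U p)) := by
  rw [Finset.mul_sum]
  exact Finset.sum_le_sum fun p _ => dist1_sq_le_four_mul _

/-! ## §5 (v1.1 APPEND, px13 g27 2026-08-31T19:56Z) The mirror line: linearised curl ≤ group size + remainder -/

/-- ★★ **LINEARISED ≤ GROUP + REMAINDER** (the mirror of §2, same ✓D inequality): `‖Y_V(∂p)[Ẑ]‖ ≤ dist1 (V(∂p)⁻¹·(Θ(Z)V)(∂p)) + (e^S − 1 − S)` — the kernel tower's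
finest DATA (`ρ_0 = ‖curl‖`) read from the purse's group-currency relative plaquette. [cite: Balaban1985Averaging, (19)-(20) p.21, (58) p.27; Balaban1987RG1, (0.8) p.253] -/
theorem norm_curl_le_dist1_relPlaq_add_rem {k : ℕ} (V : GaugeField P k (Matrix.specialUnitaryGroup (Fin N) ℂ)) (Z : PBond P k → (specialUnitaryLogChart (Fin N)).lie)
    (y : Site P k) {μ ν : Fin P.d} (hμν : μ < ν) :
    ‖covWalkSum V (fun c => ((Z c : (specialUnitaryLogChart (Fin N)).lie) : Matrix (Fin N) (Fin N) ℂ)) (walk y [((μ, true) : Letter P.d), (ν, true), (μ, false), (ν, false)])‖ ≤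
      dist1 ((GaugeField.plaqHol V ⟨y, μ, ν, hμν⟩)⁻¹ *
          GaugeField.plaqHol (fun c => (isChartRep_specialUnitaryGroup (n := Fin N)).expChart (Z c) * V c) ⟨y, μ, ν, hμν⟩) +
        (Real.exp (‖Z ⟨y, μ⟩‖ + ‖Z ⟨y.shift μ, ν⟩‖ + ‖Z ⟨y.shift ν, μ⟩‖ + ‖Z ⟨y, ν⟩‖) - 1 - (‖Z ⟨y, μ⟩‖ + ‖Z ⟨y.shift μ, ν⟩‖ + ‖Z ⟨y.shift ν, μ⟩‖ + ‖Z ⟨y, ν⟩‖)) := by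
  rw [dist1_relPlaq_left_eq_right]
  have hD := norm_coe_relPlaq_sub_one_sub_curl_le V Z y hμν
  set W : Matrix.specialUnitaryGroup (Fin N) ℂ := GaugeField.plaqHol (fun c => (isChartRep_specialUnitaryGroup (n := Fin N)).expChart (Z c) * V c) ⟨y, μ, ν, hμν⟩ *
      (GaugeField.plaqHol V ⟨y, μ, ν, hμν⟩)⁻¹ with hW
  set C : Matrix (Fin N) (Fin N) ℂ := covWalkSum V (fun c => ((Z c : (specialUnitaryLogChart (Fin N)).lie) : Matrix (Fin N) (Fin N) ℂ))
      (walk y [((μ, true) : Letter P.d), (ν, true), (μ, false), (ν, false)]) with hC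
  have hdist : dist1 W = ‖((W : Matrix.specialUnitaryGroup (Fin N) ℂ) : Matrix (Fin N) (Fin N) ℂ) - 1‖ := rfl
  rw [hdist]
  -- `C = (↑W − 1) − (↑W − 1 − C)`
  have e : C = (((W : Matrix.specialUnitaryGroup (Fin N) ℂ) : Matrix (Fin N) (Fin N) ℂ) - 1) -
      ((((W : Matrix.specialUnitaryGroup (Fin N) ℂ) : Matrix (Fin N) (Fin N) ℂ) - 1) - C) := by abel
  calc ‖C‖ = ‖(((W : Matrix.specialUnitaryGroup (Fin N) ℂ) : Matrix (Fin N) (Fin N) ℂ) - 1) -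
        ((((W : Matrix.specialUnitaryGroup (Fin N) ℂ) : Matrix (Fin N) (Fin N) ℂ) - 1) - C)‖ := by rw [← e]
    _ ≤ ‖((W : Matrix.specialUnitaryGroup (Fin N) ℂ) : Matrix (Fin N) (Fin N) ℂ) - 1‖ +
        ‖(((W : Matrix.specialUnitaryGroup (Fin N) ℂ) : Matrix (Fin N) (Fin N) ℂ) - 1) - C‖ := norm_sub_le _ _
    _ ≤ _ := add_le_add le_rfl hD

/-- ★★ **SQUARED MIRROR**: `‖Y_V(∂p)[Ẑ]‖² ≤ 2·dist1 (V(∂p)⁻¹·(Θ(Z)V)(∂p))² + 2·(e^S − 1 − S)²`. [cite: Balaban1985Averaging, (19)-(20) p.21; Balaban1987RG1, (0.8) p.253] -/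
theorem norm_curl_sq_le {k : ℕ} (V : GaugeField P k (Matrix.specialUnitaryGroup (Fin N) ℂ)) (Z : PBond P k → (specialUnitaryLogChart (Fin N)).lie) (y : Site P k)
    {μ ν : Fin P.d} (hμν : μ < ν) :
    ‖covWalkSum V (fun c => ((Z c : (specialUnitaryLogChart (Fin N)).lie) : Matrix (Fin N) (Fin N) ℂ)) (walk y [((μ, true) : Letter P.d), (ν, true), (μ, false), (ν, false)])‖ ^ 2 ≤
      2 * dist1 ((GaugeField.plaqHol V ⟨y, μ, ν, hμν⟩)⁻¹ *
          GaugeField.plaqHol (fun c => (isChartRep_specialUnitaryGroup (n := Fin N)).expChart (Z c) * V c) ⟨y, μ, ν, hμν⟩) ^ 2 +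
        2 * (Real.exp (‖Z ⟨y, μ⟩‖ + ‖Z ⟨y.shift μ, ν⟩‖ + ‖Z ⟨y.shift ν, μ⟩‖ + ‖Z ⟨y, ν⟩‖) - 1 -
          (‖Z ⟨y, μ⟩‖ + ‖Z ⟨y.shift μ, ν⟩‖ + ‖Z ⟨y.shift ν, μ⟩‖ + ‖Z ⟨y, ν⟩‖)) ^ 2 := by
  have h := norm_curl_le_dist1_relPlaq_add_rem V Z y hμν
  have h0 : 0 ≤ ‖covWalkSum V (fun c => ((Z c : (specialUnitaryLogChart (Fin N)).lie) : Matrix (Fin N) (Fin N) ℂ))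
      (walk y [((μ, true) : Letter P.d), (ν, true), (μ, false), (ν, false)])‖ := norm_nonneg _
  have h1 := pow_le_pow_left₀ h0 h 2
  nlinarith [h1, sq_nonneg (dist1 ((GaugeField.plaqHol V ⟨y, μ, ν, hμν⟩)⁻¹ *
      GaugeField.plaqHol (fun c => (isChartRep_specialUnitaryGroup (n := Fin N)).expChart (Z c) * V c) ⟨y, μ, ν, hμν⟩) -
    (Real.exp (‖Z ⟨y, μ⟩‖ + ‖Z ⟨y.shift μ, ν⟩‖ + ‖Z ⟨y.shift ν, μ⟩‖ + ‖Z ⟨y, ν⟩‖) - 1 -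
      (‖Z ⟨y, μ⟩‖ + ‖Z ⟨y.shift μ, ν⟩‖ + ‖Z ⟨y.shift ν, μ⟩‖ + ‖Z ⟨y, ν⟩‖)))]

end Summit.QuantumFields.YangMills.Theorems.FluctuationComparisonRegPrIntLS2BetaRelPlaqCurlJunction

end
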